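import Literature.MathematicalPhysics.QuantumFieldTheory.BalabanImbrieJaffe1984to88.BIJ88Sect5StatementsPart4
import Literature.MathematicalPhysics.QuantumFieldTheory.Balaban1983to89.Beta.GaussianIntegral

/-!
# `BalabanImbrieJaffe1984to88.BIJ88PertQ5715` — T. Bałaban, J. Imbrie, A. Jaffe, *Effective action and cluster properties of
the abelian Higgs model*, Commun. Math. Phys. **114** (1988) 257–315 [BalabanImbrieJaffe1988], §5.7 *Gaussian Normalization
Factors*, p. 295: the perturbative expansion **(5.7.15)** `Q^{(k)}(u_{k+1}, θ_kH_{k,loc}A^{(k)})` TYPED WITH BODY over the smooth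
family of Gaussian quadratic forms the print names, and the **(5.7.13)** SHAPE `Z(u_{k+1}ũ̃) = Z(u_{k+1})·exp[−Q^{(k)} − W]` for the
`m = k` main term PROVED as Taylor's formula with integral remainder for `e′ ↦ log ∫dφ exp(−½⟨φ, M(e′)φ⟩)`

statement-level skeleton of published theorems with citation tags; proofs where landed; nothing here is a claim about the Yang–Mills mass gap

PDF held: `paper:balaban1988-cmp114-bij-abelian-higgs-effective-action` (journal page = PDF page + 256).  Render read this
session as an image: p. 295 = PDF 39 (G4 decode `work/pages/original-p039-x2.png` of the p02 seat folder).

CITATION HEADER (lean-in-tree rule).  Part of the lit-balaban TYPED SKELETON (HOME `run/shared/lean/pub/lit-balaban/`), row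
**C2.Eq5.7.13-5.7.15** (`HOME/lit-balaban-r16/ROWS-C2-part2.md`, fold owner r16; (5.7.14) is the typed leaf `Ineq5714` with
p36's knitting `BIJ88Ineq5714Proof`, untouched here; p02 gen 4's `BIJ88TraceLog574.prod_Z49_eq574` gave the product structure of
(5.7.13) at the (4.9) level).  Members *"(5.7.13), (5.7.15) absent"* of the owner's cell.  Built BY NAME on r16's
`BIJ88Sect5StatementsPart4.pertP` / `taylor_logz` (the (5.14.2) twin) and on the tree's `Beta.GaussianIntegral`
(`integral_exp_neg_half_quadForm`, `log_integral_exp_neg_half_quadForm`); nothing restated.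

**What the paper prints (p. 295 [PDF 39], verbatim).**  *"The term m = k is treated slightly differently. We decompose Ã^η_k
into θ_kH_{k,loc}A^{(k)} + θ_kw₅A′. Terms with one or more w₅A′ field are expanded as in the m < k case. In terms with all
θ_kH_{k,loc}A^{(k)} fields, we expand the propagators as before, leaving in the main terms the localized propagator
G_{k,loc}(u_{k+1}). The result is our standard perturbative expansion in the field θ_kH_{k,loc}A^{(k)}, which we denote
Q^{(k)}(u_{k+1}, θ_kH_{k,loc}A^{(k)}). The remainder terms become Σ_X W^{(k)(vi)}(X), with |W^{(k)(vi)}(X)| ≦ e^{−cr(e_k)|X|}.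
We can summarize the results of this section as follows:
  Π_{j=0}^{k−1} Z^{(j)}_{Λ^{(j)}_{10}}(u_{k+1}ũ̃) = Π_{j=0}^{k−1} Z^{(j)}_{Λ^{(j)}_{10}}(u_{k+1}) exp[−Q^{(k)}(u_{k+1}, θ_kH_{k,loc}A^{(k)}) −
    Σ_X W^{(k)}_2(X)],   (5.7.13)
where X is a connected union of r(e_k)-cubes in T^{(k)}_1, W^{(k)}_2(X) = Σ_{j=0}^k W^{(j)′}(X) + … + W^{(j)(vi)}(X), …   (5.7.14)
and
  Q^{(k)}(u_{k+1}, θ_kH_{k,loc}A^{(k)}) = Σ_{n=1}^{n̄} (dⁿ/de′ⁿ) log[∫dφ|_{Λ̄^{(k)}_4} exp(−½⟨φ, G_{k,loc}(u_{k+1}e^{ie′e_kηθ_kH_{k,loc}A^{(k)}})⁻¹φ⟩)]_{e′=0}.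
    (5.7.15)"*

**The model (finite-dimensional, exactly the printed generality of the Gaussian in (5.7.15)).**  The sites of `Λ̄^{(k)}_4` (real
coordinates of `φ`) ↦ a finite type `n`; the quadratic form `G_{k,loc}(u_{k+1}e^{ie′e_kηθ_kH_{k,loc}A^{(k)}})⁻¹` restricted to
`Λ̄^{(k)}_4` ↦ a family `Mf : ℝ → Matrix n n ℝ` of real matrices, positive definite for `e′ ∈ [0, 1]`, whose entries are `C^m` in `e′`
(DATA: the print's family is real-analytic in `e′` through `u_{k+1}e^{ie′(…)}`); `dφ|_{Λ̄_4}` = Lebesgue measure.  Then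
`Zloc Mf e′ := ∫dφ exp(−½⟨φ, M(e′)φ⟩)` is the bracket of (5.7.15) (`e′ = 0`: the main-term normalization at `u_{k+1}`; `e′ = 1`: at
`u_{k+1}ũ̃_θ`, `ũ̃_θ = e^{ie_kηθ_kH_{k,loc}A^{(k)}}`), and `logZ Mf = log ∘ Zloc Mf`.

**What is kernel-checked (zero `sorry`, standard axioms, no new named facts).**
 * `Zloc_eq` / `logZ_eq`: the bracket in closed form, `log ∫dφ e^{−½⟨φ,M(e′)φ⟩} = (|n|/2)·log 2π − ½·log det M(e′)`;
 * `contDiffOn_det` (entries `C^m` ⇒ `det` `C^m`, Leibniz formula) and **`contDiffOn_logZ`**: `e′ ↦ log[∫dφ …]` IS `C^m` on `[0,1]` — the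
   derivatives in (5.7.15) exist to every order the entries allow;
 * **(5.7.15)** `pertQ5715 Mf n̄ := Σ_{n=1}^{n̄} −(1/n!)(dⁿ/de′ⁿ) logZ|_{e′=0}` — READ WITH THE TAYLOR WEIGHTS AND SIGN of the sister
   display (5.14.2) p. 308 (*"𝒫̃_{k+1} = Σ_{α=1}^{n̄} −(1/α!)(d^α/dt^α) log z_t|_{t=0}"*), i.e. `= BIJ88Sect5StatementsPart4.pertP (logZ Mf) n̄`
   BY NAME; the bare printed *"Σ_{n=1}^{n̄} dⁿ/de′ⁿ"* is typed too, `pertQ5715Literal` (TRANSCRIPTION NOTE HOME/GAPS.md G-C2-15, cf.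
   G-C2-11 on (5.6.14): only with the weights `−1/n!` is `−Q^{(k)}` the order-`n̄` part of `log Z(1) − log Z(0)` and the remainder of
   order `n̄ + 1`, as (5.7.13) requires);
 * **(5.7.13) shape for the main term**, `logZ_one_eq` / **`eq5713_main`**: `Zloc(1) = Zloc(0) · exp[−Q^{(k)} − W]` with
   `W = remW5713 := −∫₀¹ ((1−t)^{n̄}/n̄!) (d^{n̄+1}/de′^{n̄+1}) logZ dt` — Taylor's formula with integral remainder (r16's
   `taylor_logz`), the hypothesis `logZ ∈ C^{n̄+1}[0,1]` DISCHARGED from the entries by `contDiffOn_logZ` (`eq5713_main_of_entries`).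
**Readings (declared).**  (i) `Mf` is data standing for the matrix of `G_{k,loc}(…e′…)⁻¹` on `Λ̄_4`; (ii) `W` is the `m = k` main-term
contribution to `Σ_X W₂^{(k)}(X)` BEFORE its localization into connected `X` (the localization and the bound (5.7.14) are not
touched: p36's `BIJ88Ineq5714Proof`); (iii) the products `Π_{j<k} Z^{(j)}` and the `w₅A′` terms of (5.7.13) are the other rows'
material ((5.7.5)–(5.7.12)).  **Not claimed.**  (5.7.14); the identification of the perturbative terms with *"diagrams … covered
by our theorems"*; anything of B1–B16.  NOT summit progress; NOT continuum; NOT Clay.  Imports Literature only; no Summits import;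
modifies nothing.  Cell `lit-balaban` Phase 2, seat p02 gen 6.
-/

open MeasureTheory Matrix Finset
open scoped BigOperators

namespace Literature.MathematicalPhysics.QuantumFieldTheory.BalabanImbrieJaffe1984to88.BIJ88PertQ5715

open Balaban1983to89.Beta

noncomputable section

variable {n : Type} [Fintype n] [DecidableEq n] (Mf : ℝ → Matrix n n ℝ)

/-! ## §1 The bracket of (5.7.15): `e′ ↦ ∫dφ exp(−½⟨φ, M(e′)φ⟩)` and its logarithm -/

/-- The bracket of (5.7.15): `∫dφ|_{Λ̄^{(k)}_4} exp(−½⟨φ, G_{k,loc}(u_{k+1}e^{ie′e_kηθ_kH_{k,loc}A^{(k)}})⁻¹φ⟩)` as a function of `e′`,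
`Mf e′` the matrix of the quadratic form. [cite: BalabanImbrieJaffe1988, (5.7.15) p.295] -/
def Zloc (e' : ℝ) : ℝ := ∫ φ : n → ℝ, Real.exp (-(1 / 2 : ℝ) * (φ ⬝ᵥ Mf e' *ᵥ φ))

/-- `log[∫dφ|_{Λ̄_4} exp(−½⟨φ, M(e′)φ⟩)]`, the function differentiated in (5.7.15). [cite: BalabanImbrieJaffe1988, (5.7.15) p.295] -/
def logZ (e' : ℝ) : ℝ := Real.log (Zloc Mf e')

/-- The bracket in closed form: `∫dφ e^{−½⟨φ,Mφ⟩} = √(2π)^{|n|}/√(det M)` (`M` positive definite).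
[cite: BalabanImbrieJaffe1988, (5.7.15) p.295] -/
theorem Zloc_eq {e' : ℝ} (h : (Mf e').PosDef) :
    Zloc Mf e' = Real.sqrt (2 * Real.pi) ^ Fintype.card n / Real.sqrt (Mf e').det :=
  GaussianIntegral.integral_exp_neg_half_quadForm _ h

/-- The bracket is positive. [cite: BalabanImbrieJaffe1988, (5.7.15) p.295] -/
theorem Zloc_pos {e' : ℝ} (h : (Mf e').PosDef) : 0 < Zloc Mf e' := by
  rw [Zloc_eq Mf h]
  exact div_pos (pow_pos (Real.sqrt_pos.2 (by positivity)) _) (Real.sqrt_pos.2 h.det_pos)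

/-- `log[∫dφ e^{−½⟨φ,M(e′)φ⟩}] = (|n|/2)·log 2π − ½·log det M(e′)`. [cite: BalabanImbrieJaffe1988, (5.7.15) p.295] -/
theorem logZ_eq {e' : ℝ} (h : (Mf e').PosDef) :
    logZ Mf e' = (Fintype.card n : ℝ) / 2 * Real.log (2 * Real.pi) - (1 / 2 : ℝ) * Real.log (Mf e').det :=
  GaussianIntegral.log_integral_exp_neg_half_quadForm _ h

/-- `exp (logZ) = Zloc`. [cite: BalabanImbrieJaffe1988, (5.7.15) p.295] -/
theorem exp_logZ {e' : ℝ} (h : (Mf e').PosDef) : Real.exp (logZ Mf e') = Zloc Mf e' :=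
  Real.exp_log (Zloc_pos Mf h)

/-! ## §2 Smoothness in `e′` -/

/-- The determinant of a `C^m` family of matrices is `C^m` (Leibniz formula). [folklore] [cite: BalabanImbrieJaffe1988, (5.7.15) p.295] -/
theorem contDiffOn_det {m : WithTop ℕ∞} {s : Set ℝ} (hC : ∀ i j, ContDiffOn ℝ m (fun e' => Mf e' i j) s) :
    ContDiffOn ℝ m (fun e' => (Mf e').det) s := by
  classical
  have h : (fun e' => (Mf e').det)
      = fun e' => ∑ σ : Equiv.Perm n, ((Equiv.Perm.sign σ : ℤ) : ℝ) * ∏ i, Mf e' (σ i) i := by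
    funext e'
    exact Matrix.det_apply' _
  rw [h]
  refine ContDiffOn.sum fun σ _ => ?_
  exact contDiffOn_const.mul (contDiffOn_prod fun i _ => hC (σ i) i)

/-- **The function of (5.7.15) is `C^m`**: if the entries of `M(e′)` are `C^m` on `s` and `M(e′)` is positive definite there, then
`e′ ↦ log[∫dφ exp(−½⟨φ, M(e′)φ⟩)]` is `C^m` on `s` — the `e′`-derivatives of (5.7.15) exist to every such order.
[cite: BalabanImbrieJaffe1988, (5.7.15) p.295] -/
theorem contDiffOn_logZ {m : WithTop ℕ∞} {s : Set ℝ} (hM : ∀ e' ∈ s, (Mf e').PosDef)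
    (hC : ∀ i j, ContDiffOn ℝ m (fun e' => Mf e' i j) s) : ContDiffOn ℝ m (logZ Mf) s := by
  have h1 : ContDiffOn ℝ m
      (fun e' => (Fintype.card n : ℝ) / 2 * Real.log (2 * Real.pi) - (1 / 2 : ℝ) * Real.log (Mf e').det) s :=
    contDiffOn_const.sub (contDiffOn_const.mul ((contDiffOn_det Mf hC).log fun e' he' => (hM e' he').det_pos.ne'))
  exact h1.congr fun e' he' => logZ_eq Mf (hM e' he')

/-! ## §3 (5.7.15) and the (5.7.13) shape for the main term -/

/-- **(5.7.15)** p. 295, *"Q^{(k)}(u_{k+1}, θ_kH_{k,loc}A^{(k)}) = Σ_{n=1}^{n̄} (dⁿ/de′ⁿ) log[∫dφ|_{Λ̄_4} exp(−½⟨φ, G_{k,loc}(u_{k+1}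
e^{ie′e_kηθ_kH_{k,loc}A^{(k)}})⁻¹φ⟩)]_{e′=0}"* — typed WITH the Taylor weights and sign of the sister display (5.14.2):
`Σ_{n=1}^{n̄} −(1/n!)(dⁿ/de′ⁿ) logZ|₀`, i.e. r16's `pertP` applied to `logZ` (derivatives within `[0,1]`; transcription note G-C2-15).
[cite: BalabanImbrieJaffe1988, (5.7.15) p.295] -/
def pertQ5715 (nbar : ℕ) : ℝ :=
  BIJ88Sect5StatementsPart4.pertP (logZ Mf) nbar

/-- (5.7.15) READ LITERALLY (bare `Σ_{n=1}^{n̄} dⁿ/de′ⁿ`, no weights, no sign) — recorded for the transcription note G-C2-15; the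
cell's statement of record is `pertQ5715`. [cite: BalabanImbrieJaffe1988, (5.7.15) p.295] -/
def pertQ5715Literal (nbar : ℕ) : ℝ :=
  ∑ j ∈ Finset.range nbar, iteratedDerivWithin (j + 1) (logZ Mf) (Set.uIcc 0 1) 0

omit [DecidableEq n] in
/-- `pertQ5715` unfolded: `Q^{(k)} = Σ_{n=1}^{n̄} −(1/n!) (dⁿ/de′ⁿ) logZ (0)`. [cite: BalabanImbrieJaffe1988, (5.7.15) p.295] -/
theorem pertQ5715_eq (nbar : ℕ) :
    pertQ5715 Mf nbar
      = ∑ j ∈ Finset.range nbar, -((1 : ℝ) / (j + 1).factorial) * iteratedDerivWithin (j + 1) (logZ Mf) (Set.uIcc 0 1) 0 :=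
  rfl

/-- The `m = k` main-term contribution to `Σ_X W₂^{(k)}(X)` of (5.7.13) before localization: minus the Taylor integral remainder of
order `n̄ + 1` of `e′ ↦ logZ(e′)` between `0` and `1`. [cite: BalabanImbrieJaffe1988, (5.7.13) p.295] -/
def remW5713 (nbar : ℕ) : ℝ :=
  -∫ t in (0 : ℝ)..1, ((1 - t) ^ nbar / nbar.factorial) * iteratedDerivWithin (nbar + 1) (logZ Mf) (Set.uIcc 0 1) t

omit [DecidableEq n] in
/-- Taylor's formula for the function of (5.7.15): `logZ(1) = logZ(0) − Q^{(k)} − W` for `logZ` of class `C^{n̄+1}` on `[0,1]`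
(r16's `BIJ88Sect5StatementsPart4.taylor_logz`). [cite: BalabanImbrieJaffe1988, (5.7.13) p.295] -/
theorem logZ_one_eq {nbar : ℕ} (h : ContDiffOn ℝ (nbar + 1 : ℕ) (logZ Mf) (Set.uIcc 0 1)) :
    logZ Mf 1 = logZ Mf 0 - pertQ5715 Mf nbar - remW5713 Mf nbar := by
  rw [pertQ5715, remW5713, BIJ88Sect5StatementsPart4.taylor_logz h]
  ring

/-- **(5.7.13), the shape for the `m = k` main term** p. 295, *"Π Z(u_{k+1}ũ̃) = Π Z(u_{k+1}) exp[−Q^{(k)}(u_{k+1}, θ_kH_{k,loc}A^{(k)})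
− Σ_X W^{(k)}_2(X)]"* — PROVED on the model: with `Z(e′) = ∫dφ exp(−½⟨φ, M(e′)φ⟩)` positive definite on `[0,1]` and `log Z` of class
`C^{n̄+1}` there, `Z(1) = Z(0) · exp[−Q^{(k)} − W]`, `Q^{(k)} = pertQ5715` (the order-`n̄` perturbative part), `W = remW5713` (the
remainder of order `n̄+1`). [cite: BalabanImbrieJaffe1988, (5.7.13) p.295] -/
theorem eq5713_main {nbar : ℕ} (hM : ∀ e' ∈ Set.uIcc (0 : ℝ) 1, (Mf e').PosDef)
    (h : ContDiffOn ℝ (nbar + 1 : ℕ) (logZ Mf) (Set.uIcc 0 1)) :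
    Zloc Mf 1 = Zloc Mf 0 * Real.exp (-pertQ5715 Mf nbar - remW5713 Mf nbar) := by
  have h0 : (Mf 0).PosDef := hM 0 Set.left_mem_uIcc
  have h1 : (Mf 1).PosDef := hM 1 Set.right_mem_uIcc
  rw [← exp_logZ Mf h1, ← exp_logZ Mf h0, ← Real.exp_add, logZ_one_eq Mf h]
  congr 1
  ring

/-- **(5.7.13) for the main term with the smoothness DISCHARGED from the entries**: `M(e′)` positive definite on `[0,1]` with
`C^{n̄+1}` entries ⇒ `Z(1) = Z(0) · exp[−Q^{(k)} − W]`. [cite: BalabanImbrieJaffe1988, (5.7.13) p.295] -/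
theorem eq5713_main_of_entries {nbar : ℕ} (hM : ∀ e' ∈ Set.uIcc (0 : ℝ) 1, (Mf e').PosDef)
    (hC : ∀ i j, ContDiffOn ℝ (nbar + 1 : ℕ) (fun e' => Mf e' i j) (Set.uIcc 0 1)) :
    Zloc Mf 1 = Zloc Mf 0 * Real.exp (-pertQ5715 Mf nbar - remW5713 Mf nbar) :=
  eq5713_main Mf hM (contDiffOn_logZ Mf hM hC)

/-- The same in logarithmic form: `log Z(1) − log Z(0) = −Q^{(k)} − W`. [cite: BalabanImbrieJaffe1988, (5.7.13) p.295] -/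
theorem logZ_one_sub_logZ_zero {nbar : ℕ} (hM : ∀ e' ∈ Set.uIcc (0 : ℝ) 1, (Mf e').PosDef)
    (hC : ∀ i j, ContDiffOn ℝ (nbar + 1 : ℕ) (fun e' => Mf e' i j) (Set.uIcc 0 1)) :
    logZ Mf 1 - logZ Mf 0 = -pertQ5715 Mf nbar - remW5713 Mf nbar := by
  rw [logZ_one_eq Mf (contDiffOn_logZ Mf hM hC)]
  ring

end

end Literature.MathematicalPhysics.QuantumFieldTheory.BalabanImbrieJaffe1984to88.BIJ88PertQ5715
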